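import Summits.QuantumFields.YangMills.Theorems.BalabanLadderIRPinnedExitCofinal
import Summits.QuantumFields.YangMills.Theorems.BalabanLadderIRRankPurityCofinal
import Summits.QuantumFields.YangMills.Theses.BalabanLadder
import Summits.QuantumFields.YangMills.Theorems.BalabanLadderIRcofTemporalTwistSubadditivity
import Literature.MathematicalPhysics.QuantumFieldTheory.WilsonFinTorusTwistedPartitionDomination
import Literature.MathematicalPhysics.QuantumFieldTheory.WilsonFinTorusMagneticFluxSectors
import HarnessLib

/-!
# Crux `IRcof` (stmt-QuantumFields-26930) — LINE `meso-vortex-spreading` rev 2 (ideator ym-ir-idea-23, lens `complete` = program-completion, gen 0)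
# PXcof(1∕24) ⇐ (M) MESO-SCALE VORTEX CONDENSATION ∧ (S′) TRANSVERSE GROWTH meso → pinned box ∧ (V) e-projected purity ∧ (CF) centre-free residual;
# N_cof by name.  Assembles BY TOKEN onto the slot of record `Cruxes/IRcof/Lines/pinned_cofinal_bill.lean` rev 2 {PXcof(1∕24), N_cof}
# (LEAD ym-ir-line-ab-p1): this file's `PinnedExitsCofinalAt` is that file's, VERBATIM, and `IRcof_of_stubs` concludes
# `Theses.BalabanLadder.IRcof` LITERALLY.  Nothing is registered on the slot (no `skeleton check`).

THE PROGRAMME COMPLETED (technique: LENSES-v3 `complete`): the CENTRE-VORTEX ∕ FLUX FREE-ENERGY programme for confinement of `SU(N)` at all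
couplings — 't Hooft 1978∕79 (electric∕magnetic flux free energies of a twisted 4-torus; «confinement ⟺ magnetic flux spreads, its free
energy through a cross-section `A` vanishing like `e^{−ρA}`»), Mack–Petkova 1979∕80 and Mack 1980 (thick `Z(N)` vortices of thickness
`d_c ≈` one fermi condense; «sufficient condition for confinement of static quarks by a vortex condensation mechanism»), Kovács–Tomboulis
1998∕2000 (exact `SO(3) × Z(2)` rewriting; the Wilson loop ∕ electric-flux free energy IS a vortex counter; vortex free energy computed),
Tomboulis 2007 (RP + MK decimation, located gap Ito–Seiler 2007 §2 — census B13, §L rows 41∕45, NOT re-filed here).  AUTHOR-NAMED GAPS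
(quoted by page on the card): Kovács–Tomboulis, Phys. Rev. D 57 (1998) 4054, p. 4057 [held: paper:galaxy-pdf-8800741109584872460 p0070]:
«This may then lead to area-law behavior for the expectation, PROVIDED THAT the class of thick vortex configurations contributes at large β
with a finite measure in the path integral sum»; ibid. p0071: «It would clearly be important to have the corresponding proof for the case of
the Wilson loop … the proof in [2] does not immediately extend … We will address this question elsewhere.»  The programme's two dynamical
claims are typed SEPARATELY below, in the tree's twist currency and at the slot's pinned cold box:

* (M) `MesoVortexCondensation η` (stub at `η = 1/1920`, rev 2) — AT ONE MESOSCOPIC PHYSICAL THICKNESS WINDOW `[d_lo, d_hi]` (Mack's `d_c`; `8·d_hi ≤ T`), eventually in `β`,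
  EVERY central MAGNETIC twist through the `ℓ × ℓ` transverse torus of the slab `(ℓ, ℓ, L, t)` (`d_lo ≤ a(β)ℓ ≤ d_hi`, longitudinal extents
  `ℓ ≤ L, t ≤ T/a(β)`) costs at most the fraction `η` of the untwisted slab partition function.  This is 't Hooft's «magnetic flux through a
  cross-section of one square fermi is (exponentially) free» = Mack's thick-vortex condensation at scale `d_c` = the quantity de Forcrand–von
  Smekal MEASURE (`Z_k(ℓ²)` vs. `e^{−σℓ²}`) — the programme's OPEN dynamical input, stated where the numerics live, NOT at the full box.
  False in a Coulomb phase (spread abelian flux costs `∝ L t/ℓ²`), vacuous-true for centre-free `G`.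
* (S′) `MesoToPlaneSpreading` — FLUX SPREADING = TRANSVERSE GROWTH ONLY (rev 2; 't Hooft 1979 §§4–5; the role of Mack–Petkova's
  propagation theorem): meso-slab magnetic freeness at tolerance `1/1920` ⟹ every SINGLE temporal-plane twist `z^e` (plane `(μ,3)`) of the
  pinned cold box `(L, L, L, ⌊L/4⌋)` costs at most `1/960`, eventually in `β`, on a floor-pinned window (`SinglePlaneRegimeAt`).  A temporal-plane
  twist of the box is a magnetic twist of the ROTATED box in a plane of area `L × ⌊L/4⌋` (tree: `wilsonFinTorusTensorTwistedPartition_rotate ∕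
  _swap03`); what is OPEN is only the monotonicity of the twist cost under growth of the twisted plane (`ℓ × ℓ ↦ L × ⌊L/4⌋`, longitudinal
  `(L, t) ↦ (L, L)`) — neither in the tree nor in print.  The other half of rev 1's (S) — composition of SIMULTANEOUS twists in the three
  temporal planes — is now a THEOREM of this file (§1b): 't Hooft's flux weights are non-negative at fixed magnetic background (tree
  `wilsonFinTorusMagneticFluxPartition_nonneg`, reflection positivity) so `k ↦ W{z^k}` is positive-definite on `(ℤ/n)³`, whence the defect
  `Z − W` is sub-additive with constant 2 (`temporalTwistCost_subadditive`) and single planes control the whole temporal star with constant 10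
  (`temporalTensorCost_le_of_single`).  Group-blind-true; all group-specific content sits in (M).  (Rev 1's all-tensor target `BoxRegimeAt` ∕ `MesoToBoxSpreading` is superseded and removed.)
* (V) `ProjectedBoxPurity (1/96)` — the e-PROJECTED cold box (average over the temporal twists `z^{k_μ}`, `μ = 0,1,2`, `k ∈ (Fin n)³`) is
  `1/96`-pure at a floor-pinned scale, cofinally in `β`: the NEUTRAL-SECTOR GAP = the wall (census C4, §L row 21 V ∕ row 22); BY NAME, no
  mechanism claimed; the programme completed here does not address it and the card says so.
* (CF) `CentreFreeResidual (1/24)` — PXcof VERBATIM on simply-connected compact simple `G` without a non-trivial central element of finite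
  order (= centre-free `G₂, F₄, E₈`, the centre of a compact simple group being finite; typed as the literal complement so that the case split
  is kernel-trivial; SAME WALL as §L rows 37∕42∕44 (CF), DECLARED, not claimed).
* `stub_irnscCof : IRnscCof` — N_cof BY NAME (slot token, `π₁(G) ≠ 1`).

PROVED here (no sorry): §1b — unimodular inequality `1 − Re(ab) ≤ 2(1 − Re a) + 2(1 − Re b)`, sub-additivity of the defect of a
positive-definite function on a finite abelian group (`pd_defect_subadditive`), ★ `temporalTwistCost_subadditive` (any compact `G`, continuous
unitary `ρ`, `β ≥ 0`, any magnetic background, any finite abelian group of central temporal twists, box `b₁ × b₂ × b₃ × (M+2)`), ★★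
`temporalTensorCost_le_of_single` (single temporal planes ⟹ the whole temporal star, constant 10), `eRegime_of_single`;
centrality of the twist families, the averaging lemmas, the SEAM `coldDefect ≤ 1 − (95/96)³ ≤ 1/24` from {e-projected purity, temporal-tensor
regime at `⌊L/4⌋`, twist DOMINATION at `2⌊L/4⌋` (`wilsonFinTorusTensorTwistedPartition_le_partition`, tree)} (`seam_arith` as in idea-20's
`twisted_slab_continuity.lean` §4), `eRegime_of_meso` ((M) ∧ (S′) ⇒ regime), `pxcof_of_eregime`, `pxcof_of` (case split on a non-trivial
central element of finite order), `irscCof_of_pxcof`, `IRcof_of : Bill`, `IRcof_of_stubs`.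

HONEST LABEL: ideation; nothing here proves `IRcof` (0∕1), `IR`, PX, PXcof, any leg, or the Yang–Mills mass gap (Clay: NOT proved); nothing
continuum ∕ OS; R2c stays IDEA-BOUND; R4 closes only the conditional finite-𝕋⁴ rung `BalabanLadder.UV`; numerics quoted on the card are GUIDANCE.

RE-CUT (rev 3, 2026-08-28): §1 (currency) and §1b (star sub-additivity, PROVED) were LANDED verbatim by the custody LEAD as the helper
`Theorems/BalabanLadderIRcofTemporalTwistSubadditivity.lean` (p666390, commit 0e57bfd6108f; crit-3 g3 gate word «LAND IT», crit-3 g4 TYPEREAD clean);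
this file now IMPORTS it and cites the declarations BY NAME (in-file copies deleted).  The VARIANT line answering the critic's CAUSE 1∕2 is
`Lines/meso_vortex_growth.lean` (LINE 1′: the transfer (S′) replaced by a PROVED time-growth theorem + one typed V-hypothesis).
-/

set_option autoImplicit false

noncomputable section

open Filter Topology MeasureTheory
open scoped BigOperators ComplexConjugate
open Literature.MathematicalPhysics.QuantumFieldTheory Literature.MathematicalPhysics.QuantumLattice
open Summit.QuantumFields.YangMills.Cruxes.OSLegsFromFemtoAndGap.DlrCollarTransfer (LowerBounds)
open Summit.QuantumFields.YangMills.Cruxes.IR.ColdPurityBridge (coldDefect)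
open Summit.QuantumFields.YangMills.Cruxes.IR.RankPurity (IRnscCof IRscCof IRcof_of_split)
open Summit.QuantumFields.YangMills.Cruxes.IR.PinnedExitCofinal (ircofSC_of_pinnedExitsCofinal_le)
open Summit.QuantumFields.YangMills.Cruxes.IRcof.TemporalTwistSubadditivity

namespace Summit.QuantumFields.YangMills.Cruxes.IRcof.MesoVortexSpreading

/-! ## §2 The obligation Props -/

section Props

variable {G : Type} [Group G] [TopologicalSpace G] [IsTopologicalGroup G] [CompactSpace G]
  [MeasurableSpace G] [BorelSpace G]

/-- **Inner form of (M): meso-slab magnetic freeness at tolerance `η`** for a lattice representation `r` and a unit map `a`.  There is a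
ceiling threshold `T₀`; for every ceiling `T ≥ T₀` a physical thickness window `0 < d_lo < d_hi`, `8 d_hi ≤ T`, and a coupling threshold `β₂`
such that for all `β ≥ β₂`, every slab `(ℓ, ℓ, L, t)` with `2 ≤ ℓ`, `d_lo ≤ a(β)ℓ ≤ d_hi`, `ℓ ≤ L`, `a(β)L ≤ T`, `ℓ ≤ t`, `a(β)t ≤ T`, and every
central `w`: `(1 − η)·Z(ℓ,ℓ,L,t) ≤ W{n_{01} = w}(ℓ,ℓ,L,t)`. -/
def MesoFreeAt (r : LatticeRep G) (a : ℝ → ℝ) (η : ℝ) : Prop :=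
  ∃ T₀ : ℝ, ∀ T : ℝ, T₀ ≤ T → ∃ dlo dhi : ℝ, 0 < dlo ∧ dlo < dhi ∧ 8 * dhi ≤ T ∧
    ∃ β₂ : ℝ, ∀ β : ℝ, β₂ ≤ β → ∀ ℓ L t : ℕ, 2 ≤ ℓ → dlo ≤ a β * (ℓ : ℝ) → a β * (ℓ : ℝ) ≤ dhi →
      ℓ ≤ L → a β * (L : ℝ) ≤ T → ℓ ≤ t → a β * (t : ℝ) ≤ T →
        ∀ w : G, w ∈ Subgroup.center G →
          (1 - η) * wilsonFinTorusPartition r.ρ β ℓ ℓ L t ≤ wilsonFinTorusTensorTwistedPartition r.ρ β (magTwist w) ℓ ℓ L t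

/-- **Single temporal-plane regime at the pinned cold box, tolerance `θ`** (rev 2 — the target of (S′)): a window floor `λ`; for every
ceiling `T` a threshold `β₂`; for all `β ≥ β₂`, every `L ≥ 8` with `λ ≤ a(β)L ≤ T`, every central `z`, every temporal plane `(μ,3)` and
every exponent `e`: the single-plane twist `z^e` costs at most the fraction `θ`: `Z − W{(μ,3) ↦ z^e}(L³ × ⌊L/4⌋) ≤ θ · Z(L³ × ⌊L/4⌋)`. -/
def SinglePlaneRegimeAt (r : LatticeRep G) (a : ℝ → ℝ) (θ : ℝ) : Prop :=
  ∃ lam : ℝ, ∀ T : ℝ, ∃ β₂ : ℝ, ∀ β : ℝ, β₂ ≤ β → ∀ L : ℕ, 8 ≤ L → lam ≤ a β * (L : ℝ) → a β * (L : ℝ) ≤ T →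
    ∀ z : G, z ∈ Subgroup.center G → ∀ (μ : Fin 3) (e : ℕ),
      wilsonFinTorusPartition r.ρ β L L L (L / 4) -
          wilsonFinTorusTensorTwistedPartition r.ρ β (elecMagTwistTensor (zVec z (Pi.single μ e)) 1) L L L (L / 4) ≤
        θ * wilsonFinTorusPartition r.ρ β L L L (L / 4)

/-- **Temporal-tensor regime at the pinned cold box, tolerance `θ`** — exactly what the seam consumes: every member of the temporal twist
family `eTwist z k` (`z` central of finite order `n`, `k ∈ (Fin n)³`) costs at most the fraction `θ`. -/
def ERegimeAt (r : LatticeRep G) (a : ℝ → ℝ) (θ : ℝ) : Prop :=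
  ∃ lam : ℝ, ∀ T : ℝ, ∃ β₂ : ℝ, ∀ β : ℝ, β₂ ≤ β → ∀ L : ℕ, 8 ≤ L → lam ≤ a β * (L : ℝ) → a β * (L : ℝ) ≤ T →
    ∀ z : G, z ∈ Subgroup.center G → ∀ n : ℕ, 0 < n → z ^ n = 1 → ∀ k : Fin 3 → Fin n,
      (1 - θ) * wilsonFinTorusPartition r.ρ β L L L (L / 4) ≤ wilsonFinTorusTensorTwistedPartition r.ρ β (eTwist z k) L L L (L / 4)

/-- ★ **Single planes ⟹ the temporal star (rev 2, PROVED)**: `SinglePlaneRegimeAt θ ⟹ ERegimeAt θ'` whenever `10 θ ≤ θ'` — by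
`temporalTensorCost_le_of_single` ('t Hooft flux positivity + Fourier inversion on `(ℤ/n)³`). -/
theorem eRegime_of_single (r : LatticeRep G) (a : ℝ → ℝ) {θ θ' : ℝ} (hθ : 10 * θ ≤ θ') (h : SinglePlaneRegimeAt r a θ) :
    ERegimeAt r a θ' := by
  haveI : SecondCountableTopology G :=
    (r.continuous.isClosedEmbedding r.injective).isEmbedding.secondCountableTopology
  obtain ⟨lam, hlam⟩ := h
  refine ⟨lam, fun T => ?_⟩
  obtain ⟨β₂, hβ₂⟩ := hlam T
  refine ⟨max β₂ 0, fun β hβ L hL8 hlo hhi z hz n hn hzn k => ?_⟩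
  have hβ2 : β₂ ≤ β := le_trans (le_max_left _ _) hβ
  have hβ0 : 0 ≤ β := le_trans (le_max_right _ _) hβ
  have hM : L / 4 = (L / 4 - 2) + 2 := by omega
  have hs : ∀ (μ : Fin 3) (e : ℕ), wilsonFinTorusPartition r.ρ β L L L (L / 4 - 2 + 2) -
      wilsonFinTorusTensorTwistedPartition r.ρ β (elecMagTwistTensor (zVec z (Pi.single μ e)) 1) L L L (L / 4 - 2 + 2) ≤
        θ * wilsonFinTorusPartition r.ρ β L L L (L / 4 - 2 + 2) := fun μ e => by
    rw [← hM]; exact hβ₂ β hβ2 L hL8 hlo hhi z hz μ e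
  have h10 := temporalTensorCost_le_of_single r.ρ r.continuous r.mem_unitary hβ0 hz hn hzn L (L / 4 - 2) hs k
  rw [← hM, ← eTwist_eq_elecMag] at h10
  have hZ : 0 ≤ wilsonFinTorusPartition r.ρ β L L L (L / 4) := (wilsonFinTorusPartition_pos r.continuous β L L L _).le
  nlinarith [mul_le_mul_of_nonneg_right hθ hZ]


end Props

/-- **(M) · MESO-SCALE VORTEX CONDENSATION (rank 2 — the programme's open dynamical input).**  For simply-connected compact simple `G`, every
lattice representation `r` and every positive unit map `a → 0` carrying the floor `LowerBounds G r a`: meso-slab magnetic freeness at tolerance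
`η` (`MesoFreeAt`).  't Hooft 1979: magnetic flux through one square fermi is free in the confinement mode; Mack 1980: `Z(N)` vortices of
thickness `d_c` condense; Kovács–Tomboulis 1998∕2000: the thick-vortex measure at weak coupling — NAMED OPEN by the authors.  Consumes the
floor (the window is in physical units `a(β)ℓ`).  False for abelian∕Coulomb physics; trivially true for centre-free `G`. -/
def MesoVortexCondensation (η : ℝ) : Prop :=
  ∀ (G : Type) [Group G] [TopologicalSpace G] [IsTopologicalGroup G] [CompactSpace G],
    IsCompactSimpleLieGroup G → SimplyConnectedSpace G →
    letI : MeasurableSpace G := borel G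
    haveI : BorelSpace G := ⟨rfl⟩
    ∀ (r : LatticeRep G) (a : ℝ → ℝ), (∀ β, 0 < a β) → Tendsto a atTop (𝓝 0) → LowerBounds G r a →
      MesoFreeAt r a η

/-- **(S′) · TRANSVERSE GROWTH, meso slab → single temporal planes of the pinned box (rank 3, rev 2 — the propagation step; Mack–Petkova's
theorem plays this role in print).**  For simply-connected compact simple `G`, every `r`, every positive unit map `a → 0` with the floor:
meso-slab magnetic freeness at tolerance `1/1920` ⟹ the single temporal-plane regime at tolerance `1/960` at the pinned cold box.  OPEN: only
the monotonicity of a ONE-PLANE twist cost under growth of the twisted plane `ℓ × ℓ ↦ L × ⌊L/4⌋` (and of the longitudinal extents); the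
composition of the three temporal planes is PROVED (`eRegime_of_single`). -/
def MesoToPlaneSpreading : Prop :=
  ∀ (G : Type) [Group G] [TopologicalSpace G] [IsTopologicalGroup G] [CompactSpace G],
    IsCompactSimpleLieGroup G → SimplyConnectedSpace G →
    letI : MeasurableSpace G := borel G
    haveI : BorelSpace G := ⟨rfl⟩
    ∀ (r : LatticeRep G) (a : ℝ → ℝ), (∀ β, 0 < a β) → Tendsto a atTop (𝓝 0) → LowerBounds G r a →
      MesoFreeAt r a (1 / 1920) → SinglePlaneRegimeAt r a (1 / 960)

/-- **Temporal-tensor 't Hooft regime at the pinned cold box, tolerance `θ`** — what the seam consumes (rev 2). -/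
def ETHooftRegime (θ : ℝ) : Prop :=
  ∀ (G : Type) [Group G] [TopologicalSpace G] [IsTopologicalGroup G] [CompactSpace G],
    IsCompactSimpleLieGroup G → SimplyConnectedSpace G →
    letI : MeasurableSpace G := borel G
    haveI : BorelSpace G := ⟨rfl⟩
    ∀ (r : LatticeRep G) (a : ℝ → ℝ), (∀ β, 0 < a β) → Tendsto a atTop (𝓝 0) → LowerBounds G r a →
      ERegimeAt r a θ

/-- **(V) · e-PROJECTED PURITY OF THE PINNED COLD BOX (the neutral-sector gap — THE WALL, by name).**  For simply-connected compact simple `G`,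
a central `z ≠ 1` of finite order `n`, every `r`, every positive unit map `a → 0` with the floor: for every window floor `λ` there is a ceiling
`T` such that for every `β₁` SOME `β ≥ β₁` has ONE scale `L ≥ 8` with `λ ≤ a(β)L ≤ T` at which the e-projected box `(L,L,L;⌊L/4⌋)` is `θ`-pure:
`projDefect ≤ θ`.  Census C4 ∕ §L row 21 V: no mechanism is claimed for it here. -/
def ProjectedBoxPurity (θ : ℝ) : Prop :=
  ∀ (G : Type) [Group G] [TopologicalSpace G] [IsTopologicalGroup G] [CompactSpace G],
    IsCompactSimpleLieGroup G → SimplyConnectedSpace G →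
    letI : MeasurableSpace G := borel G
    haveI : BorelSpace G := ⟨rfl⟩
    ∀ (z : G) (n : ℕ), z ∈ Subgroup.center G → z ≠ 1 → 0 < n → z ^ n = 1 →
      ∀ (r : LatticeRep G) (a : ℝ → ℝ), (∀ β, 0 < a β) → Tendsto a atTop (𝓝 0) → LowerBounds G r a →
        ∀ lam : ℝ, ∃ T : ℝ, ∀ β₁ : ℝ, ∃ β : ℝ, β₁ ≤ β ∧ ∃ L : ℕ, 8 ≤ L ∧
          lam ≤ a β * (L : ℝ) ∧ a β * (L : ℝ) ≤ T ∧ projDefect r.ρ β z n L (L / 4) ≤ θ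

/-- **(CF) · RESIDUAL (declared, not claimed): PXcof(θ) for the simply-connected compact simple groups WITHOUT a non-trivial central element of
finite order** — the centre-free types `G₂, F₄, E₈` (the centre of a compact simple group is finite); typed as the literal complement of the case
split.  Same wall as §L rows 37∕42∕44 `(CF)`. -/
def CentreFreeResidual (θ : ℝ) : Prop :=
  ∀ (G : Type) [Group G] [TopologicalSpace G] [IsTopologicalGroup G] [CompactSpace G],
    IsCompactSimpleLieGroup G → SimplyConnectedSpace G →
    letI : MeasurableSpace G := borel G
    haveI : BorelSpace G := ⟨rfl⟩
    (¬ ∃ (z : G) (n : ℕ), z ∈ Subgroup.center G ∧ z ≠ 1 ∧ 0 < n ∧ z ^ n = 1) →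
      ∀ (r : LatticeRep G) (a : ℝ → ℝ), (∀ β, 0 < a β) → Tendsto a atTop (𝓝 0) → LowerBounds G r a →
        ∃ T : ℝ, ∀ β₁ : ℝ, ∃ β : ℝ, β₁ ≤ β ∧ ∃ L : ℕ, 8 ≤ L ∧ a β * (L : ℝ) ≤ T ∧ coldDefect r.ρ β L ≤ θ

/-- **PXcof(θ)** — VERBATIM the slot's `PinnedCofinalBill.PinnedExitsCofinalAt θ` (idea-11 ∕ LEAD ab-p1). -/
def PinnedExitsCofinalAt (θ : ℝ) : Prop :=
  ∀ (G : Type) [Group G] [TopologicalSpace G] [IsTopologicalGroup G] [CompactSpace G],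
    IsCompactSimpleLieGroup G → SimplyConnectedSpace G →
    letI : MeasurableSpace G := borel G
    haveI : BorelSpace G := ⟨rfl⟩
    ∀ (r : LatticeRep G) (a : ℝ → ℝ), (∀ β, 0 < a β) → Tendsto a atTop (𝓝 0) → LowerBounds G r a →
      ∃ T : ℝ, ∀ β₁ : ℝ, ∃ β : ℝ, β₁ ≤ β ∧ ∃ L : ℕ, 8 ≤ L ∧ a β * (L : ℝ) ≤ T ∧ coldDefect r.ρ β L ≤ θ

/-! ## §3 Stubs (sorries ONLY here) -/

/-- **stub (M)** — meso-scale vortex condensation at tolerance `1/1920` (rev 2 constant); rank 2, the programme's named open input. -/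
theorem stub_mesoVortexCondensation : MesoVortexCondensation (1 / 1920) := by
  sorry

/-- **stub (S′)** — transverse growth from the meso slab to the single temporal planes of the pinned box; rank 3 (rev 2: replaces rev 1's
`MesoToBoxSpreading`, whose multi-plane half is now the theorem `eRegime_of_single`). -/
theorem stub_mesoToPlaneSpreading : MesoToPlaneSpreading := by
  sorry

/-- **stub (V)** — e-projected purity of the pinned cold box (the wall, by name). -/
theorem stub_projectedBoxPurity : ProjectedBoxPurity (1 / 96) := by
  sorry

/-- **stub (CF)** — PXcof(1∕24) for groups without a non-trivial central element of finite order (declared residual, not claimed). -/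
theorem stub_centreFreeResidual : CentreFreeResidual (1 / 24) := by
  sorry

/-- **stub N_cof** — the `π₁(G) ≠ 1` conjunct of the leaf BY NAME (slot token). -/
theorem stub_irnscCof : IRnscCof := by
  sorry

/-! ## §4 (M) ∧ (S′) ⇒ the temporal-tensor regime (PROVED) and the endpoint seam (PROVED) -/

/-- **(M) at `1/1920` and (S′) give the temporal-tensor regime at `1/96` at the pinned cold box** (through the PROVED star composition
`eRegime_of_single`, `10 · (1/960) = 1/96`). -/
theorem eRegime_of_meso (hM : MesoVortexCondensation (1 / 1920)) (hS : MesoToPlaneSpreading) : ETHooftRegime (1 / 96) := by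
  intro G _ _ _ _ hG hsc
  letI : MeasurableSpace G := borel G
  haveI : BorelSpace G := ⟨rfl⟩
  intro r a ha ha0 hlb
  exact eRegime_of_single r a (by norm_num) (hS G hG hsc r a ha ha0 hlb (hM G hG hsc r a ha ha0 hlb))

section Seam

private theorem avg_le {ι : Type} [Fintype ι] [Nonempty ι] (f : ι → ℝ) (b : ℝ) (h : ∀ k, f k ≤ b) :
    ((Fintype.card ι : ℕ) : ℝ)⁻¹ * ∑ k, f k ≤ b := by
  have hs : ∑ k, f k ≤ ∑ _k : ι, b := Finset.sum_le_sum fun k _ => h k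
  simp only [Finset.sum_const, Finset.card_univ, nsmul_eq_mul] at hs
  have hn' : (0 : ℝ) < (Fintype.card ι : ℕ) := by exact_mod_cast Fintype.card_pos
  rw [inv_mul_le_iff₀ hn']
  exact hs

private theorem le_avg {ι : Type} [Fintype ι] [Nonempty ι] (f : ι → ℝ) (b : ℝ) (h : ∀ k, b ≤ f k) :
    b ≤ ((Fintype.card ι : ℕ) : ℝ)⁻¹ * ∑ k, f k := by
  have hs : ∑ _k : ι, b ≤ ∑ k, f k := Finset.sum_le_sum fun k _ => h k
  simp only [Finset.sum_const, Finset.card_univ, nsmul_eq_mul] at hs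
  have hn' : (0 : ℝ) < (Fintype.card ι : ℕ) := by exact_mod_cast Fintype.card_pos
  rw [le_inv_mul_iff₀ hn']
  exact hs

/-- **The arithmetic of the seam** (as in `twisted_slab_continuity.lean` §4).  If `P ≥ (95/96)·Zt > 0` (flux regime, averaged),
`P₂ ≤ Z₂` (domination, averaged) and `1 − P₂/P² ≤ 1/96` (projected purity), then `1 − Z₂/Zt² ≤ 1/24`. -/
theorem seam_arith {Zt Z2 P P2 : ℝ} (hZt : 0 < Zt) (hP : (1 - 1 / 96) * Zt ≤ P) (hP2 : P2 ≤ Z2)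
    (hpure : 1 - P2 / P ^ 2 ≤ 1 / 96) : 1 - Z2 / Zt ^ 2 ≤ 1 / 24 := by
  have hPpos : 0 < P := lt_of_lt_of_le (by positivity) hP
  have hP2sq : 0 < P ^ 2 := by positivity
  have h1 : (1 - 1 / 96) * P ^ 2 ≤ P2 := by
    have := hpure
    rw [sub_le_iff_le_add] at this
    have h' : 1 - 1 / 96 ≤ P2 / P ^ 2 := by linarith
    rwa [le_div_iff₀ hP2sq] at h'
  have h2 : (1 - 1 / 96) ^ 2 * Zt ^ 2 ≤ P ^ 2 := by
    have h0 : 0 ≤ (1 - 1 / 96) * Zt := by positivity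
    nlinarith [hP, h0]
  have h3 : (1 - 1 / 96) ^ 3 * Zt ^ 2 ≤ Z2 := by nlinarith [h1, h2, hP2]
  have hZt2 : 0 < Zt ^ 2 := by positivity
  have h4 : (1 - 1 / 96) ^ 3 ≤ Z2 / Zt ^ 2 := by
    rw [le_div_iff₀ hZt2]; exact h3
  nlinarith [h4]

end Seam

/-! ## §5 Composition (PROVED, stub-free): (M) ∧ (S′) ∧ (V) ∧ (CF) ⇒ PXcof(1∕24) ⇒ IRscCof; with N_cof ⇒ `IRcof` BY NAME -/

/-- **PXcof(1∕24) from the temporal-tensor regime, e-projected purity and the residual.**  Case split on a non-trivial central element `z` of finite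
order `n`: if there is one, (V) picks the ceiling, the coupling and the scale, the regime holds there for every member of the temporal twist
family `eTwist z k` at `⌊L/4⌋`, domination holds at `2⌊L/4⌋`, and `seam_arith` gives `coldDefect ≤ 1/24`; otherwise (CF) is the statement. -/
theorem pxcof_of_eregime (hH : ETHooftRegime (1 / 96)) (hV : ProjectedBoxPurity (1 / 96)) (hR : CentreFreeResidual (1 / 24)) :
    PinnedExitsCofinalAt (1 / 24) := by
  intro G _ _ _ _ hG hsc
  letI : MeasurableSpace G := borel G
  haveI : BorelSpace G := ⟨rfl⟩
  intro r a ha ha0 hlb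
  haveI : SecondCountableTopology G :=
    (r.continuous.isClosedEmbedding r.injective).isEmbedding.secondCountableTopology
  by_cases hex : ∃ (z : G) (n : ℕ), z ∈ Subgroup.center G ∧ z ≠ 1 ∧ 0 < n ∧ z ^ n = 1
  · obtain ⟨z, n, hz, hz1, hn, hzn⟩ := hex
    haveI : NeZero n := ⟨Nat.pos_iff_ne_zero.mp hn⟩
    haveI : Nonempty (Fin 3 → Fin n) := ⟨fun _ => 0⟩
    obtain ⟨lam, hH'⟩ := hH G hG hsc r a ha ha0 hlb
    obtain ⟨T, hT⟩ := hV G hG hsc z n hz hz1 hn hzn r a ha ha0 hlb lam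
    obtain ⟨β₂, hβ₂⟩ := hH' T
    refine ⟨T, fun β₁ => ?_⟩
    obtain ⟨β, hβ, L, hL8, hlam, hpin, hend⟩ := hT (max β₁ (max β₂ 0))
    have hβ1 : β₁ ≤ β := le_trans (le_max_left _ _) hβ
    have hβ2 : β₂ ≤ β := le_trans (le_trans (le_max_left _ _) (le_max_right _ _)) hβ
    have hβ0 : 0 ≤ β := le_trans (le_trans (le_max_right _ _) (le_max_right _ _)) hβ
    refine ⟨β, hβ1, L, hL8, hpin, ?_⟩
    have hcent : ∀ k : Fin 3 → Fin n, ∀ μ ν : Fin 4, eTwist z k μ ν ∈ Subgroup.center G :=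
      fun k μ ν => eTwist_center hz k μ ν
    have hflux : ∀ k : Fin 3 → Fin n, (1 - 1 / 96) * wilsonFinTorusPartition r.ρ β L L L (L / 4) ≤
        wilsonFinTorusTensorTwistedPartition r.ρ β (eTwist z k) L L L (L / 4) :=
      fun k => hβ₂ β hβ2 L hL8 hlam hpin z hz n hn hzn k
    have hL2 : 2 ≤ L := by omega
    have h2t : 2 ≤ 2 * (L / 4) := by omega
    have hdom : ∀ k : Fin 3 → Fin n, wilsonFinTorusTensorTwistedPartition r.ρ β (eTwist z k) L L L (2 * (L / 4)) ≤
        wilsonFinTorusPartition r.ρ β L L L (2 * (L / 4)) :=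
      fun k => wilsonFinTorusTensorTwistedPartition_le_partition r.ρ r.continuous r.mem_unitary hβ0
        (fun μ ν _ => hcent k μ ν) hL2 hL2 h2t
    have hP : (1 - 1 / 96) * wilsonFinTorusPartition r.ρ β L L L (L / 4) ≤ projZ r.ρ β z n L (L / 4) :=
      le_avg _ _ hflux
    have hP2 : projZ r.ρ β z n L (2 * (L / 4)) ≤ wilsonFinTorusPartition r.ρ β L L L (2 * (L / 4)) :=
      avg_le _ _ hdom
    have hZt : 0 < wilsonFinTorusPartition r.ρ β L L L (L / 4) := wilsonFinTorusPartition_pos r.continuous β L L L _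
    have hpure : 1 - projZ r.ρ β z n L (2 * (L / 4)) / projZ r.ρ β z n L (L / 4) ^ 2 ≤ 1 / 96 := hend
    show 1 - wilsonFinTorusPartition r.ρ β L L L (2 * (L / 4)) / wilsonFinTorusPartition r.ρ β L L L (L / 4) ^ 2 ≤ 1 / 24
    exact seam_arith hZt hP hP2 hpure
  · exact hR G hG hsc hex r a ha ha0 hlb

/-- **PXcof(1∕24) from the four `π₁ = 1` obligations of the line (rev 2: (M) at `1/1920`, (S′) transverse growth).** -/
theorem pxcof_of (hM : MesoVortexCondensation (1 / 1920)) (hS : MesoToPlaneSpreading) (hV : ProjectedBoxPurity (1 / 96))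
    (hR : CentreFreeResidual (1 / 24)) : PinnedExitsCofinalAt (1 / 24) :=
  pxcof_of_eregime (eRegime_of_meso hM hS) hV hR

/-- PXcof(θ ≤ 1∕24) ⇒ the simply-connected conjunct `IRscCof` of the leaf (landed kernel `ircofSC_of_pinnedExitsCofinal_le`). -/
theorem irscCof_of_pxcof {θ : ℝ} (hθ : θ ≤ 1 / 24) (hP : PinnedExitsCofinalAt θ) : IRscCof := by
  intro G _ _ _ _ hG hsc
  exact ircofSC_of_pinnedExitsCofinal_le hθ hP G hG hsc

/-- The bill as ONE proposition (behind a `def`, so that `IRcof_of_stubs` is the file's only crux-headed theorem). -/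
def Bill : Prop :=
  MesoVortexCondensation (1 / 1920) → MesoToPlaneSpreading → ProjectedBoxPurity (1 / 96) → CentreFreeResidual (1 / 24) → IRnscCof →
    Summit.QuantumFields.YangMills.Theses.BalabanLadder.IRcof

/-- **The bill holds** (PROVED composition, stub-free): `(M) → (S′) → (V) → (CF) → N_cof → IRcof`. -/
theorem IRcof_of : Bill := fun hM hS hV hR hN =>
  IRcof_of_split (irscCof_of_pxcof le_rfl (pxcof_of hM hS hV hR)) hN

/-- **`IRcof` (the route's decl, literally) from the five stubs.** -/
theorem IRcof_of_stubs : Summit.QuantumFields.YangMills.Theses.BalabanLadder.IRcof :=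
  IRcof_of stub_mesoVortexCondensation stub_mesoToPlaneSpreading stub_projectedBoxPurity stub_centreFreeResidual stub_irnscCof

end Summit.QuantumFields.YangMills.Cruxes.IRcof.MesoVortexSpreading

end
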